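import Literature.NumberTheory.EllipticCurves.BinaryQuarticTwoCoveringsTwist
import Mathlib.Algebra.Module.Submodule.Union
import Literature.NumberTheory.QuadraticForms.HasseMinkowski
import HarnessLib

/-!
# Two-coverings attached to binary quartic forms, VIII: Galois bookkeeping for surjectivity

Topic `Literature/NumberTheory/EllipticCurves`. Eighth file of the theory proving the named fact
`Literature.NumberTheory.EllipticCurves.bhargavaShankar_card_selmerTwo_eq_kEquivClassCount`.
Given a continuous `1`-cocycle `φ : Γ_ℚ → E_{A,B}[2]` (a representative of a class in
`H¹(ℚ, E[2])`), we set up the combinatorial data of the surjectivity proof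
(Birch–Swinnerton-Dyer 1963, Lemma 1; Cremona 2001, §5), all through the bootstrap form `f₀` of
file VII, whose torsor differences `T_k = T(r₀, r_k)` enumerate `E[2]`:

* `§1` the root permutation `rootPerm σ` (`σ r_k = r_{κ_σ k}`, `κ_σ 0 = 0` since `r₀ ∈ ℚ`), a
  homomorphism `Γ_ℚ → S₄`; the torsors `Tb k` with `Tb (k ⊕ l) = Tb k + Tb l`, `σ • Tb k =
  Tb (κ_σ k)` and `E[2] = {Tb k}`;
* `§2` the index function `idx φ σ` (`φ σ = Tb (idx σ)`) with the cocycle identity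
  `idx (στ) = idx σ ⊕ κ_σ (idx τ)`, and the open normal subgroup
  `H_φ = {σ | κ_σ = 1, idx σ = 0}` with finite quotient;
* `§3` the twisted semilinear action `twist σ θ i = sgn (idx σ) i · σ (θ (κ_σ⁻¹ i))` on functions
  `θ : Fin 4 → ℚ̄` (an action: `twist (στ) = twist σ ∘ twist τ`; trivial on `H_φ` for `θ` valued
  in the fixed field of `H_φ`);
* `§4` generic Galois theory over a field `K` of characteristic `0`: distinct cosets of a closed
  subgroup of `Gal(K̄/K)` restrict to distinct embeddings of its fixed field
  (`exists_out_apply_ne`), and these embeddings are linearly independent over `K̄`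
  (`linearIndependent_cosetEmb`, Dedekind–Artin);
* `§5` the Poincaré series `avgTwist θ = Σ_{q ∈ Γ/H_φ} q̃ ∗ θ`: twisted-invariant
  (`twist_avgTwist`), and nonvanishing at `i = 1, 2, 3` for a suitable `θ`
  (`exists_avgTwist_ne_zero`: Artin independence plus "a vector space over an infinite field is
  not a finite union of proper subspaces");
* `§6` the twisted invariant `w = twInv` (`σ(w_{κ⁻¹i}) = sgn · wᵢ`), the plain invariant `δ = w²`
  (`σ(δⱼ) = δ_{κⱼ}`), the roots `eᵢ = eb i` of the cubic (Vieta, distinctness, `F′(eᵢ) ≠ 0`), and the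
  Galois-fixed hence rational Hankel entries `Q_n = Σᵢ δᵢ eᵢⁿ/F′(eᵢ)` (`conicEntryQ`, `conicMat`);
* `§7` the conic as a quadratic form: `ᵗv Q v = Σᵢ (δᵢ/F′(eᵢ))(v₀ + v₁eᵢ + v₂eᵢ²)²` over `ℚ̄`
  (`toBilin'_conicMat_map`) and `det Q ≠ 0` (`conicMat_det_ne_zero`, Vandermonde factorisation).

## References

* B. J. Birch, H. P. F. Swinnerton-Dyer, *Notes on elliptic curves. I*, J. reine angew. Math. 212
  (1963), Lemma 1. [BirchSwinnertonDyer1963]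
* J. E. Cremona, *Classical invariants and 2-descent on elliptic curves*, J. Symbolic Comput. 31
  (2001), §5. [Cremona2001]
* M. Bhargava, A. Shankar, Ann. of Math. (2) 181 (2015), Lemma 5.2 (arXiv:1006.1002v2 numbering).
  [BhargavaShankarAnnals2015]
-/

noncomputable section

open scoped Classical

universe u

namespace Literature.NumberTheory.EllipticCurves

namespace TwoCovering

open BinaryQuartic WeierstrassCurve WeierstrassCurve.Affine GaloisRepresentations

/-! ## §1 The root permutation and the torsors of the bootstrap form -/

section RootPerm

/-- An element of `Γ_ℚ` as a `ℚ`-algebra automorphism of `ℚ̄` (the identity, as a reducible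
coercion helper: `Field.absoluteGaloisGroup` is a plain `def`). [folklore] -/
abbrev gal (σ : Field.absoluteGaloisGroup ℚ) : AlgebraicClosure ℚ ≃ₐ[ℚ] AlgebraicClosure ℚ := σ

/-- The action of `Γ_ℚ` on `E(ℚ̄)` is `Point.map (gal σ)`. [folklore] -/
theorem smul_geomPoints_eq_gal {AB : ℤ × ℤ} (σ : Field.absoluteGaloisGroup ℚ) (P : geomPoints (shortWeierstrass AB)) :
    σ • P = Point.map (gal σ : AlgebraicClosure ℚ →ₐ[ℚ] AlgebraicClosure ℚ) P :=
  rfl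

/-- `gal` is multiplicative. [folklore] -/
theorem gal_mul (σ τ : Field.absoluteGaloisGroup ℚ) : gal (σ * τ) = gal σ * gal τ := rfl

/-- `gal (σ * τ) x = gal σ (gal τ x)`. [folklore] -/
theorem gal_mul_apply (σ τ : Field.absoluteGaloisGroup ℚ) (x : AlgebraicClosure ℚ) :
    gal (σ * τ) x = gal σ (gal τ x) := rfl

variable {AB : ℤ × ℤ} (hE : 4 * AB.1 ^ 3 + 27 * AB.2 ^ 2 ≠ 0)
include hE

/-- The bootstrap form over `ℚ̄` is in the `E_{A,B}`-family (`t = 2`). [folklore] -/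
theorem setup_bootForm_map :
    Setup ((bootForm AB).map (algebraMap ℚ (AlgebraicClosure ℚ))) (algebraMap ℚ _ (AB.1 : ℚ))
      (algebraMap ℚ _ (AB.2 : ℚ)) (algebraMap ℚ _ 2) :=
  (setup_bootForm hE).map _

/-- The roots of the bootstrap form are distinct. [folklore] -/
theorem bootData_injective : Function.Injective (bootData (Ω := AlgebraicClosure ℚ) hE).r :=
  (bootData hE).injective (setup_bootForm_map hE).disc_ne_zero

/-- The image index of a root under `σ`: `σ r_k = r_{k'}` for some `k'`. [folklore] -/
theorem exists_apply_bootData_eq (σ : Field.absoluteGaloisGroup ℚ) (k : Fin 4) :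
    ∃ k' : Fin 4, gal σ ((bootData hE).r k) = (bootData (Ω := AlgebraicClosure ℚ) hE).r k' :=
  exists_eq_r (bootData hE) (setup_bootForm hE).a_ne (eval_apply_eq_zero _ ((bootData hE).eval_r k))

/-- **The root permutation** `κ_σ ∈ S₄` of `σ ∈ Γ_ℚ` on the roots of the bootstrap form:
`σ r_k = r_{κ_σ k}`. [folklore] -/
def rootPerm (σ : Field.absoluteGaloisGroup ℚ) : Equiv.Perm (Fin 4) :=
  Equiv.ofBijective (fun k ↦ Classical.choose (exists_apply_bootData_eq hE σ k))
    (Finite.injective_iff_bijective.mp fun k l hkl ↦ by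
      have hk := Classical.choose_spec (exists_apply_bootData_eq hE σ k)
      have hl := Classical.choose_spec (exists_apply_bootData_eq hE σ l)
      rw [show Classical.choose (exists_apply_bootData_eq hE σ k) = Classical.choose
        (exists_apply_bootData_eq hE σ l) from hkl, ← hl] at hk
      exact bootData_injective hE ((gal σ).injective hk))

/-- Defining property of the root permutation: `σ r_k = r_{κ_σ k}`. [folklore] -/
theorem rootPerm_spec (σ : Field.absoluteGaloisGroup ℚ) (k : Fin 4) :
    gal σ ((bootData hE).r k) = (bootData (Ω := AlgebraicClosure ℚ) hE).r (rootPerm hE σ k) :=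
  Classical.choose_spec (exists_apply_bootData_eq hE σ k)

/-- The root permutation is characterised by its defining property. [folklore] -/
theorem rootPerm_eq_iff (σ : Field.absoluteGaloisGroup ℚ) (k k' : Fin 4) :
    rootPerm hE σ k = k' ↔ gal σ ((bootData hE).r k) = (bootData (Ω := AlgebraicClosure ℚ) hE).r k' := by
  constructor
  · rintro rfl; exact rootPerm_spec hE σ k
  · intro h
    rw [rootPerm_spec hE σ k] at h
    exact bootData_injective hE h

/-- `κ_σ 0 = 0`: the rational root is fixed. [folklore] -/
theorem rootPerm_zero (σ : Field.absoluteGaloisGroup ℚ) : rootPerm hE σ 0 = 0 :=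
  (rootPerm_eq_iff hE σ 0 0).mpr (apply_bootData_zero hE _)

/-- `κ` is a homomorphism: `κ_{στ} = κ_σ κ_τ`. [folklore] -/
theorem rootPerm_mul (σ τ : Field.absoluteGaloisGroup ℚ) : rootPerm hE (σ * τ) = rootPerm hE σ * rootPerm hE τ := by
  refine Equiv.ext fun k ↦ ?_
  rw [Equiv.Perm.mul_apply]
  apply (rootPerm_eq_iff hE _ _ _).mpr
  rw [gal_mul_apply, rootPerm_spec hE τ k, rootPerm_spec hE σ]

/-- `κ_1 = 1`. [folklore] -/
theorem rootPerm_one : rootPerm hE 1 = 1 :=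
  Equiv.ext fun k ↦ (rootPerm_eq_iff hE 1 k k).mpr rfl

/-- `κ_{σ⁻¹} = κ_σ⁻¹`. [folklore] -/
theorem rootPerm_inv (σ : Field.absoluteGaloisGroup ℚ) : rootPerm hE σ⁻¹ = (rootPerm hE σ)⁻¹ := by
  have h := rootPerm_mul hE σ σ⁻¹
  rw [mul_inv_cancel, rootPerm_one] at h
  exact eq_inv_of_mul_eq_one_right h.symm

/-- **The torsors of the bootstrap form**: `Tb k = T(r₀, r_k) ∈ E_{A,B}(ℚ̄)`. [folklore] -/
def Tb (k : Fin 4) : geomPoints (shortWeierstrass AB) :=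
  geomTorsorPt AB (bootForm AB) 2 ((bootData (Ω := AlgebraicClosure ℚ) hE).r 0) ((bootData hE).r k)

/-- Unfolding `Tb` to a torsor difference on `E(ℚ̄)`. [folklore] -/
theorem Tb_eq (k : Fin 4) : Tb hE k = torsorPt ((shortWeierstrass AB).baseChange (AlgebraicClosure ℚ)).toAffine
    ((bootForm AB).map (algebraMap ℚ _)) (algebraMap ℚ _ 2) ((bootData hE).r 0) ((bootData hE).r k) := rfl

/-- `Tb 0 = O`. [folklore] -/
theorem Tb_zero : Tb hE 0 = 0 := torsorPt_self _ _ _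

/-- The torsors are `2`-torsion. [folklore] -/
theorem Tb_mem (k : Fin 4) : Tb hE k ∈ geomTorsion (shortWeierstrass AB) 2 := geomTorsorPt_mem _ _

/-- **The Klein group law**: `Tb (k ⊕ l) = Tb k + Tb l`. [folklore] -/
theorem Tb_v4add (k l : Fin 4) : Tb hE (v4add k l) = Tb hE k + Tb hE l := by
  have h := setup_bootForm_map hE
  have h3 : (3 : AlgebraicClosure ℚ) ≠ 0 := by norm_num
  exact (torsorPt_v4add (bootData hE) (isShortModel_ratCast AB _) h.a_ne h3 h.disc_ne_zero h.t_ne h.I_eq h.J_eq k l).symm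

/-- `Tb k + Tb k = O`. [folklore] -/
theorem Tb_add_self (k : Fin 4) : Tb hE k + Tb hE k = 0 := by
  rw [← Tb_v4add, v4add_self, Tb_zero]

/-- **`Tb` is injective**: distinct indices give distinct torsors. [folklore] -/
theorem Tb_injective : Function.Injective (Tb hE) := by
  intro k l hkl
  have h := setup_bootForm_map hE
  have h3 : (3 : AlgebraicClosure ℚ) ≠ 0 := by norm_num
  exact torsorPt_zero_injective (bootData hE) (isShortModel_ratCast AB _) h.a_ne h3 h.disc_ne_zero h.t_ne
    h.I_eq h.J_eq hkl

/-- **`E[2] = {Tb k}`**: every `2`-torsion point of `E_{A,B}(ℚ̄)` is one of the four torsors.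
[folklore] -/
theorem exists_eq_Tb {P : geomPoints (shortWeierstrass AB)} (hP : P ∈ geomTorsion (shortWeierstrass AB) 2) :
    ∃ k, P = Tb hE k := by
  have h := setup_bootForm_map hE
  have h2 : (2 : AlgebraicClosure ℚ) ≠ 0 := by norm_num
  have h3 : (3 : AlgebraicClosure ℚ) ≠ 0 := by norm_num
  rw [mem_geomTorsion_two_iff] at hP
  exact exists_eq_torsorPt (bootData hE) (isShortModel_ratCast AB _) h2 h.a_ne h3 h.disc_ne_zero h.t_ne h.I_eq
    h.J_eq P hP

/-- **The (untwisted) Galois action on `E[2]`**: `σ • Tb k = Tb (κ_σ k)`. [folklore] -/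
theorem smul_Tb (σ : Field.absoluteGaloisGroup ℚ) (k : Fin 4) : σ • Tb hE k = Tb hE (rootPerm hE σ k) := by
  have hmap := map_torsorPt_eq (W := shortWeierstrass AB) (g := bootForm AB) (t := (2 : ℚ))
    (gal σ : AlgebraicClosure ℚ →ₐ[ℚ] AlgebraicClosure ℚ) (gal σ) (fun _ ↦ rfl) ((bootData hE).r 0) ((bootData hE).r k)
  rw [rootPerm_spec hE σ k, rootPerm_spec hE σ 0, rootPerm_zero] at hmap
  exact hmap

end RootPerm

/-! ## §2 The index function of a cocycle and the open normal subgroup `H_φ` -/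

section Idx

variable {AB : ℤ × ℤ} (hE : 4 * AB.1 ^ 3 + 27 * AB.2 ^ 2 ≠ 0)
  (φ : contOneCocycles (discreteTopRep (Field.absoluteGaloisGroup ℚ) (geomTorsion (shortWeierstrass AB) 2)))

/-- The action in the discrete representation on `E[2]` is the Galois action on points. [folklore] -/
theorem coe_rho_apply (σ : Field.absoluteGaloisGroup ℚ) (v : geomTorsion (shortWeierstrass AB) 2) :
    (((discreteTopRep (Field.absoluteGaloisGroup ℚ) (geomTorsion (shortWeierstrass AB) 2)).ρ σ v :
      geomTorsion (shortWeierstrass AB) 2) : geomPoints (shortWeierstrass AB)) = σ • (v : geomPoints _) :=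
  rfl

include hE

/-- Every value of `φ` is one of the torsors `Tb k`. [folklore] -/
theorem exists_idx (σ : Field.absoluteGaloisGroup ℚ) :
    ∃ k : Fin 4, ((φ.1 σ : geomTorsion _ 2) : geomPoints (shortWeierstrass AB)) = Tb hE k :=
  exists_eq_Tb hE (φ.1 σ).2

/-- **The index function** of the cocycle: `φ σ = Tb (idx σ)`. [folklore] -/
def idx (σ : Field.absoluteGaloisGroup ℚ) : Fin 4 :=
  Classical.choose (exists_idx hE φ σ)

/-- Defining property of `idx`. [folklore] -/
theorem idx_spec (σ : Field.absoluteGaloisGroup ℚ) :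
    ((φ.1 σ : geomTorsion _ 2) : geomPoints (shortWeierstrass AB)) = Tb hE (idx hE φ σ) :=
  Classical.choose_spec (exists_idx hE φ σ)

/-- `idx` is characterised by its defining property. [folklore] -/
theorem idx_eq_iff (σ : Field.absoluteGaloisGroup ℚ) (k : Fin 4) :
    idx hE φ σ = k ↔ ((φ.1 σ : geomTorsion _ 2) : geomPoints (shortWeierstrass AB)) = Tb hE k := by
  constructor
  · rintro rfl; exact idx_spec hE φ σ
  · intro h
    rw [idx_spec hE φ σ] at h
    exact Tb_injective hE h

/-- `idx 1 = 0`. [folklore] -/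
theorem idx_one : idx hE φ 1 = 0 := by
  rw [idx_eq_iff, contOneCocycles.apply_one, Tb_zero]; rfl

/-- **The cocycle identity on indices**: `idx (στ) = idx σ ⊕ κ_σ (idx τ)`. [folklore] -/
theorem idx_mul (σ τ : Field.absoluteGaloisGroup ℚ) :
    idx hE φ (σ * τ) = v4add (idx hE φ σ) (rootPerm hE σ (idx hE φ τ)) := by
  apply (idx_eq_iff hE φ _ _).mpr
  have h := congrArg (fun x : geomTorsion (shortWeierstrass AB) 2 ↦ (x : geomPoints (shortWeierstrass AB))) (φ.2 σ τ)
  simp only [AddMemClass.coe_add] at h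
  rw [h, idx_spec hE φ σ, Tb_v4add, ← smul_Tb, ← idx_spec hE φ τ]
  rfl

/-- `κ_σ (idx σ⁻¹) = idx σ`. [folklore] -/
theorem rootPerm_idx_inv (σ : Field.absoluteGaloisGroup ℚ) : rootPerm hE σ (idx hE φ σ⁻¹) = idx hE φ σ := by
  have h := idx_mul hE φ σ σ⁻¹
  rw [mul_inv_cancel, idx_one, eq_comm, v4add_eq_zero_iff] at h
  exact h.symm

/-- **The subgroup `H_φ`** of `σ` acting trivially on the roots of the bootstrap form and with
`φ σ = O`. [folklore] -/
def fqKer : Subgroup (Field.absoluteGaloisGroup ℚ) where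
  carrier := {σ | rootPerm hE σ = 1 ∧ idx hE φ σ = 0}
  one_mem' := ⟨rootPerm_one hE, idx_one hE φ⟩
  mul_mem' := by
    rintro σ τ ⟨hσ1, hσ2⟩ ⟨hτ1, hτ2⟩
    refine ⟨by rw [rootPerm_mul, hσ1, hτ1, mul_one], ?_⟩
    rw [idx_mul, hσ2, hτ2, hσ1, Equiv.Perm.one_apply, v4add_self]
  inv_mem' := by
    rintro σ ⟨hσ1, hσ2⟩
    refine ⟨by rw [rootPerm_inv, hσ1, inv_one], ?_⟩
    have h := rootPerm_idx_inv hE φ σ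
    rwa [hσ1, Equiv.Perm.one_apply, hσ2] at h

/-- Membership in `H_φ`. [folklore] -/
theorem mem_fqKer_iff (σ : Field.absoluteGaloisGroup ℚ) :
    σ ∈ fqKer hE φ ↔ rootPerm hE σ = 1 ∧ idx hE φ σ = 0 :=
  Iff.rfl

/-- `H_φ` is normal. [folklore] -/
theorem fqKer_normal : (fqKer hE φ).Normal := by
  refine ⟨fun n hn g ↦ ?_⟩
  obtain ⟨hn1, hn2⟩ := hn
  refine ⟨?_, ?_⟩
  · rw [rootPerm_mul, rootPerm_mul, hn1, mul_one, rootPerm_inv, mul_inv_cancel]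
  · rw [idx_mul, idx_mul, hn2, rootPerm_zero, v4add_zero, rootPerm_mul, hn1, mul_one, rootPerm_idx_inv, v4add_self]

/-- `H_φ` is normal (instance form). [folklore] -/
instance fqKer_normal' : (fqKer hE φ).Normal := fqKer_normal hE φ

/-- `H_φ` is open: it is the intersection of the root stabilisers with the zero set of the
continuous cocycle (discrete target). [folklore] -/
theorem isOpen_fqKer : IsOpen (fqKer hE φ : Set (Field.absoluteGaloisGroup ℚ)) := by
  have h1 : IsOpen {σ : Field.absoluteGaloisGroup ℚ | rootPerm hE σ = 1} := by
    have : {σ : Field.absoluteGaloisGroup ℚ | rootPerm hE σ = 1} =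
        ⋂ k : Fin 4, {σ | gal σ ((bootData hE).r k) = (bootData (Ω := AlgebraicClosure ℚ) hE).r k} := by
      ext σ
      simp only [Set.mem_setOf_eq, Set.mem_iInter]
      constructor
      · intro h k; rw [rootPerm_spec hE σ k, h, Equiv.Perm.one_apply]
      · intro h; exact Equiv.ext fun k ↦ (rootPerm_eq_iff hE σ k k).mpr (h k)
    rw [this]
    exact isOpen_iInter_of_finite fun k ↦ isOpen_setOf_apply_eq
      (isIntegral_of_eval_eq_zero (setup_bootForm hE).a_ne ((bootData hE).eval_r k)) _
  have h2 : IsOpen {σ : Field.absoluteGaloisGroup ℚ | idx hE φ σ = 0} := by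
    have : {σ : Field.absoluteGaloisGroup ℚ | idx hE φ σ = 0} = φ.1 ⁻¹' {0} := by
      ext σ
      simp only [Set.mem_setOf_eq, Set.mem_preimage, Set.mem_singleton_iff]
      rw [idx_eq_iff, Tb_zero]
      constructor
      · intro h; exact Subtype.ext h
      · intro h; rw [h]; rfl
    rw [this]
    exact (isOpen_discrete _).preimage φ.1.continuous
  exact h1.inter h2

/-- The quotient `Γ_ℚ ⧸ H_φ` is finite (open subgroup of a compact group). [folklore] -/
instance finite_quotient_fqKer : Finite (Field.absoluteGaloisGroup ℚ ⧸ fqKer hE φ) :=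
  Subgroup.quotient_finite_of_isOpen _ (isOpen_fqKer hE φ)

/-- On `H_φ`, the root permutation is trivial. [folklore] -/
theorem rootPerm_of_mem {σ : Field.absoluteGaloisGroup ℚ} (h : σ ∈ fqKer hE φ) : rootPerm hE σ = 1 := h.1

/-- On `H_φ`, the index is `0`. [folklore] -/
theorem idx_of_mem {σ : Field.absoluteGaloisGroup ℚ} (h : σ ∈ fqKer hE φ) : idx hE φ σ = 0 := h.2

/-- `idx` and `rootPerm` are constant on left cosets of `H_φ`: `idx (σ h) = idx σ`. [folklore] -/
theorem idx_mul_of_mem (σ : Field.absoluteGaloisGroup ℚ) {h : Field.absoluteGaloisGroup ℚ} (hh : h ∈ fqKer hE φ) :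
    idx hE φ (σ * h) = idx hE φ σ := by
  rw [idx_mul, idx_of_mem hE φ hh, rootPerm_zero, v4add_zero]

/-- `rootPerm (σ h) = rootPerm σ` for `h ∈ H_φ`. [folklore] -/
theorem rootPerm_mul_of_mem (σ : Field.absoluteGaloisGroup ℚ) {h : Field.absoluteGaloisGroup ℚ}
    (hh : h ∈ fqKer hE φ) : rootPerm hE (σ * h) = rootPerm hE σ := by
  rw [rootPerm_mul, rootPerm_of_mem hE φ hh, mul_one]

end Idx

/-! ## §3 The twisted semilinear action on functions -/

section Twist

variable {AB : ℤ × ℤ} (hE : 4 * AB.1 ^ 3 + 27 * AB.2 ^ 2 ≠ 0)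
  (φ : contOneCocycles (discreteTopRep (Field.absoluteGaloisGroup ℚ) (geomTorsion (shortWeierstrass AB) 2)))

/-- **The twisted action** of `σ ∈ Γ_ℚ` on functions `θ : Fin 4 → ℚ̄` (indices `1,2,3` ↔ the
roots `eᵢ` of the cubic, i.e. `E[2] ∖ O`): `(σ ∗ θ)(i) = sgn (idx σ) i · σ (θ (κ_σ⁻¹ i))`
— the Galois action on `L ⊗ ℚ̄ = Maps(E[2]∖O, ℚ̄)` twisted by the cocycle `φ` through the
Weil-pairing characters. [folklore] -/
def twist (σ : Field.absoluteGaloisGroup ℚ) (θ : Fin 4 → AlgebraicClosure ℚ) (i : Fin 4) : AlgebraicClosure ℚ :=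
  (sgn (idx hE φ σ) i : AlgebraicClosure ℚ) * gal σ (θ ((rootPerm hE σ)⁻¹ i))

/-- Unfolding `twist`. [folklore] -/
theorem twist_apply (σ : Field.absoluteGaloisGroup ℚ) (θ : Fin 4 → AlgebraicClosure ℚ) (i : Fin 4) :
    twist hE φ σ θ i = (sgn (idx hE φ σ) i : AlgebraicClosure ℚ) * gal σ (θ ((rootPerm hE σ)⁻¹ i)) := rfl

/-- **`twist` is an action**: `(στ) ∗ θ = σ ∗ (τ ∗ θ)` (cocycle identity of `φ`, multiplicativity
and Galois-equivariance of the sign characters). [folklore] -/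
theorem twist_mul (σ τ : Field.absoluteGaloisGroup ℚ) (θ : Fin 4 → AlgebraicClosure ℚ) :
    twist hE φ (σ * τ) θ = twist hE φ σ (twist hE φ τ θ) := by
  funext i
  simp only [twist_apply, map_mul, map_intCast, idx_mul, rootPerm_mul, sgn_v4add, Int.cast_mul, mul_inv_rev,
    Equiv.Perm.mul_apply, gal_mul_apply]
  have hs : sgn (rootPerm hE σ (idx hE φ τ)) i = sgn (idx hE φ τ) ((rootPerm hE σ)⁻¹ i) := by
    conv_lhs => rw [show i = rootPerm hE σ ((rootPerm hE σ)⁻¹ i) by simp]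
    exact sgn_perm _ (rootPerm_zero hE σ) _ _
  rw [hs]
  ring

/-- `twist 1 = id`. [folklore] -/
theorem twist_one (θ : Fin 4 → AlgebraicClosure ℚ) : twist hE φ 1 θ = θ := by
  funext i
  simp only [twist_apply, idx_one, rootPerm_one, sgn, inv_one, Equiv.Perm.one_apply, true_or, or_true, if_true,
    Int.cast_one, one_mul]
  rfl

/-- **`H_φ` acts trivially** on functions with values fixed by `H_φ`. [folklore] -/
theorem twist_of_mem {h : Field.absoluteGaloisGroup ℚ} (hh : h ∈ fqKer hE φ) (θ : Fin 4 → AlgebraicClosure ℚ)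
    (hθ : ∀ j, gal h (θ j) = θ j) : twist hE φ h θ = θ := by
  funext i
  rw [twist_apply, idx_of_mem hE φ hh, rootPerm_of_mem hE φ hh, inv_one, Equiv.Perm.one_apply, hθ]
  simp [sgn]

/-- Squares are untwisted: `(σ ∗ θ)(i)² = σ (θ(κ_σ⁻¹ i)²)`. [folklore] -/
theorem twist_sq (σ : Field.absoluteGaloisGroup ℚ) (θ : Fin 4 → AlgebraicClosure ℚ) (i : Fin 4) :
    twist hE φ σ θ i ^ 2 = gal σ (θ ((rootPerm hE σ)⁻¹ i) ^ 2) := by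
  rw [twist_apply, mul_pow, map_pow, ← Int.cast_pow, sq (sgn _ _), sgn_sq, Int.cast_one, one_mul]

end Twist

/-! ## §4 Generic Galois theory: distinct cosets give distinct embeddings; Artin independence -/

section Artin

variable (K : Type*) [Field K] [CharZero K]

/-- For a closed subgroup `H` of `Gal(K̄/K)`, the fixing subgroup of its fixed field is `H`
(infinite Galois correspondence). [folklore] -/
theorem fixingSubgroup_fixedField_eq (H : Subgroup (AlgebraicClosure K ≃ₐ[K] AlgebraicClosure K))
    (hH : IsClosed (H : Set (AlgebraicClosure K ≃ₐ[K] AlgebraicClosure K))) :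
    (IntermediateField.fixedField H).fixingSubgroup = H := by
  haveI : IsGalois K (AlgebraicClosure K) := {}
  exact InfiniteGalois.fixingSubgroup_fixedField ⟨H, hH⟩

/-- **Distinct cosets of a closed subgroup restrict to distinct embeddings of its fixed field.**
[folklore] -/
theorem exists_out_apply_ne (H : Subgroup (AlgebraicClosure K ≃ₐ[K] AlgebraicClosure K))
    (hH : IsClosed (H : Set (AlgebraicClosure K ≃ₐ[K] AlgebraicClosure K)))
    {q q' : (AlgebraicClosure K ≃ₐ[K] AlgebraicClosure K) ⧸ H} (hqq : q ≠ q') :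
    ∃ x : IntermediateField.fixedField H, q.out (x : AlgebraicClosure K) ≠ q'.out (x : AlgebraicClosure K) := by
  by_contra hall
  push Not at hall
  apply hqq
  have hmem : (q.out)⁻¹ * q'.out ∈ (IntermediateField.fixedField H).fixingSubgroup := by
    rw [IntermediateField.mem_fixingSubgroup_iff]
    intro x hx
    change q.out⁻¹ (q'.out x) = x
    rw [AlgEquiv.aut_inv, AlgEquiv.symm_apply_eq]
    exact (hall ⟨x, hx⟩).symm
  rw [fixingSubgroup_fixedField_eq K H hH] at hmem
  rw [← QuotientGroup.out_eq' q, ← QuotientGroup.out_eq' q', QuotientGroup.eq]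
  exact hmem

/-- The embedding of the fixed field of `H` given by a coset representative. [folklore] -/
def cosetEmb (H : Subgroup (AlgebraicClosure K ≃ₐ[K] AlgebraicClosure K))
    (q : (AlgebraicClosure K ≃ₐ[K] AlgebraicClosure K) ⧸ H) :
    IntermediateField.fixedField H →* AlgebraicClosure K where
  toFun x := q.out (x : AlgebraicClosure K)
  map_one' := by simp
  map_mul' x y := by simp

/-- `cosetEmb` is injective in the coset (closed `H`). [folklore] -/
theorem cosetEmb_injective (H : Subgroup (AlgebraicClosure K ≃ₐ[K] AlgebraicClosure K))
    (hH : IsClosed (H : Set (AlgebraicClosure K ≃ₐ[K] AlgebraicClosure K))) :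
    Function.Injective (cosetEmb K H) := by
  intro q q' h
  by_contra hqq
  obtain ⟨x, hx⟩ := exists_out_apply_ne K H hH hqq
  exact hx (DFunLike.congr_fun h x)

/-- **Artin independence for coset embeddings**: the embeddings `x ↦ q.out x` of the fixed field
of a closed subgroup `H`, indexed by `q ∈ Γ ⧸ H`, are linearly independent over `K̄` (Dedekind–Artin
independence of characters). [folklore] -/
theorem linearIndependent_cosetEmb (H : Subgroup (AlgebraicClosure K ≃ₐ[K] AlgebraicClosure K))
    (hH : IsClosed (H : Set (AlgebraicClosure K ≃ₐ[K] AlgebraicClosure K))) :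
    LinearIndependent (AlgebraicClosure K) (fun q : (AlgebraicClosure K ≃ₐ[K] AlgebraicClosure K) ⧸ H ↦
      ((cosetEmb K H q : IntermediateField.fixedField H →* AlgebraicClosure K) :
        IntermediateField.fixedField H → AlgebraicClosure K)) :=
  (linearIndependent_monoidHom (IntermediateField.fixedField H) (AlgebraicClosure K)).comp
    (cosetEmb K H) (cosetEmb_injective K H hH)

end Artin

/-! ## §5 Averaging: nonvanishing twisted invariants -/

section Average

variable {AB : ℤ × ℤ} (hE : 4 * AB.1 ^ 3 + 27 * AB.2 ^ 2 ≠ 0)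
  (φ : contOneCocycles (discreteTopRep (Field.absoluteGaloisGroup ℚ) (geomTorsion (shortWeierstrass AB) 2)))

/-- A (noncomputable) `Fintype` structure on the finite quotient `Γ_ℚ ⧸ H_φ`. [folklore] -/
instance fintype_quotient_fqKer : Fintype (Field.absoluteGaloisGroup ℚ ⧸ fqKer hE φ) := Fintype.ofFinite _

/-- The fixed field `M_φ = ℚ̄^{H_φ}` (a finite Galois extension of `ℚ` containing the roots of the
cubic and trivialising `φ`). [folklore] -/
def fixF : IntermediateField ℚ (AlgebraicClosure ℚ) :=
  IntermediateField.fixedField (fqKer hE φ)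

/-- Elements of `M_φ` are fixed by `H_φ`. [folklore] -/
theorem gal_apply_fixF {h : Field.absoluteGaloisGroup ℚ} (hh : h ∈ fqKer hE φ) (x : fixF hE φ) :
    gal h (x : AlgebraicClosure ℚ) = x :=
  x.2 ⟨h, hh⟩

/-- `twist` is additive in `θ`. [folklore] -/
theorem twist_add (σ : Field.absoluteGaloisGroup ℚ) (θ θ' : Fin 4 → AlgebraicClosure ℚ) :
    twist hE φ σ (θ + θ') = twist hE φ σ θ + twist hE φ σ θ' := by
  funext i; simp only [twist_apply, Pi.add_apply, map_add]; ring

/-- `twist` commutes with finite sums in `θ`. [folklore] -/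
theorem twist_sum {ι : Type*} (s : Finset ι) (σ : Field.absoluteGaloisGroup ℚ) (θ : ι → Fin 4 → AlgebraicClosure ℚ) :
    twist hE φ σ (∑ j ∈ s, θ j) = ∑ j ∈ s, twist hE φ σ (θ j) := by
  induction s using Finset.induction_on with
  | empty =>
    funext i; simp [twist_apply]
  | insert a s ha ih =>
    rw [Finset.sum_insert ha, Finset.sum_insert ha, twist_add, ih]

/-- **The averaged (Poincaré series) function** `w = Σ_{q ∈ Γ/H_φ} q̃ ∗ θ` of a function `θ`
with values in `M_φ`. [folklore] -/
def avgTwist (θ : Fin 4 → fixF hE φ) : Fin 4 → AlgebraicClosure ℚ :=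
  ∑ q : Field.absoluteGaloisGroup ℚ ⧸ fqKer hE φ, twist hE φ q.out (fun j ↦ (θ j : AlgebraicClosure ℚ))

/-- **The averaged function is twisted-invariant**: `σ ∗ w = w` for all `σ ∈ Γ_ℚ`. [folklore] -/
theorem twist_avgTwist (θ : Fin 4 → fixF hE φ) (σ : Field.absoluteGaloisGroup ℚ) :
    twist hE φ σ (avgTwist hE φ θ) = avgTwist hE φ θ := by
  rw [avgTwist, twist_sum]
  -- `σ ∗ (q̃ ∗ θ) = (σ q̃) ∗ θ = ((σ q)~ h) ∗ θ = (σ q)~ ∗ θ`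
  have key : ∀ q : Field.absoluteGaloisGroup ℚ ⧸ fqKer hE φ,
      twist hE φ σ (twist hE φ q.out fun j ↦ (θ j : AlgebraicClosure ℚ)) =
        twist hE φ (σ • q).out fun j ↦ (θ j : AlgebraicClosure ℚ) := by
    intro q
    rw [← twist_mul]
    obtain ⟨h, hh⟩ := QuotientGroup.mk_out_eq_mul (fqKer hE φ) (σ * q.out)
    have hσq : (σ • q) = (QuotientGroup.mk (σ * q.out) : Field.absoluteGaloisGroup ℚ ⧸ fqKer hE φ) := by
      conv_lhs => rw [← QuotientGroup.out_eq' q]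
      rfl
    rw [hσq, hh, twist_mul hE φ (σ * q.out) (h : Field.absoluteGaloisGroup ℚ),
      twist_of_mem hE φ h.2 _ (fun j ↦ gal_apply_fixF hE φ h.2 (θ j))]
  simp_rw [key]
  exact Fintype.sum_equiv (MulAction.toPerm σ) _ _ fun q ↦ rfl

/-- The averaging map at index `i`, as a `ℚ`-linear map in `θ`. [folklore] -/
def avgLin (i : Fin 4) : (Fin 4 → fixF hE φ) →ₗ[ℚ] AlgebraicClosure ℚ where
  toFun θ := avgTwist hE φ θ i
  map_add' θ θ' := by
    simp only [avgTwist, Finset.sum_apply]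
    rw [← Finset.sum_add_distrib]
    refine Finset.sum_congr rfl fun q _ ↦ ?_
    rw [← Pi.add_apply (twist hE φ q.out _) (twist hE φ q.out _), ← twist_add]
    rfl
  map_smul' c θ := by
    simp only [avgTwist, Finset.sum_apply, RingHom.id_apply]
    rw [Finset.smul_sum]
    refine Finset.sum_congr rfl fun q _ ↦ ?_
    simp only [twist_apply, Pi.smul_apply, IntermediateField.coe_smul]
    rw [Algebra.smul_def, Algebra.smul_def, map_mul, AlgEquiv.commutes]
    ring

/-- **Nonvanishing averaged invariants exist**: there is `θ : Fin 4 → M_φ` whose average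
`w = Σ q̃ ∗ θ` has `w(i) ≠ 0` for `i = 1, 2, 3` (Artin independence of the coset embeddings and
"a vector space over an infinite field is not a finite union of proper subspaces"). [folklore] -/
theorem exists_avgTwist_ne_zero : ∃ θ : Fin 4 → fixF hE φ, ∀ i : Fin 4, i ≠ 0 → avgTwist hE φ θ i ≠ 0 := by
  -- each `avgLin i` is nonzero: test on functions supported at `i`
  have hne : ∀ i : Fin 4, i ≠ 0 → LinearMap.ker (avgLin hE φ i) ≠ ⊤ := by
    intro i hi htop
    -- coefficients of the embeddings on functions supported at `i`
    have hclosed : IsClosed ((fqKer hE φ : Subgroup (Field.absoluteGaloisGroup ℚ)) : Set (Field.absoluteGaloisGroup ℚ)) :=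
      Subgroup.isClosed_of_isOpen _ (isOpen_fqKer hE φ)
    let c : Field.absoluteGaloisGroup ℚ ⧸ fqKer hE φ → AlgebraicClosure ℚ := fun q ↦
      if (rootPerm hE q.out)⁻¹ i = i then (sgn (idx hE φ q.out) i : AlgebraicClosure ℚ) else 0
    have hc : ∃ q, c q ≠ 0 := by
      refine ⟨QuotientGroup.mk 1, ?_⟩
      obtain ⟨h, hh⟩ := QuotientGroup.mk_out_eq_mul (fqKer hE φ) (1 : Field.absoluteGaloisGroup ℚ)
      simp only [c, hh, one_mul, rootPerm_of_mem hE φ h.2, inv_one, Equiv.Perm.one_apply, if_true]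
      rw [idx_of_mem hE φ h.2]
      simp [sgn]
    have hli := linearIndependent_cosetEmb ℚ (fqKer hE φ) hclosed
    have hterm : ∀ (q : Field.absoluteGaloisGroup ℚ ⧸ fqKer hE φ) (x : fixF hE φ),
        c q * cosetEmb ℚ (fqKer hE φ) q x =
          twist hE φ q.out (fun j ↦ ((Pi.single i x : Fin 4 → fixF hE φ) j : AlgebraicClosure ℚ)) i := by
      intro q x
      simp only [twist_apply, c]
      split_ifs with hq
      · rw [hq, Pi.single_eq_same]; rfl
      · rw [Pi.single_eq_of_ne hq, zero_mul]; simp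
    have hzero : ∀ x : fixF hE φ, avgTwist hE φ (Pi.single i x) i = 0 := by
      intro x
      have hθ : (Pi.single i x : Fin 4 → fixF hE φ) ∈ LinearMap.ker (avgLin hE φ i) := by
        rw [htop]; exact Submodule.mem_top
      exact LinearMap.mem_ker.mp hθ
    obtain ⟨q₀, hq₀⟩ := hc
    apply hq₀
    refine linearIndependent_iff'.mp hli (Finset.univ : Finset (Field.absoluteGaloisGroup ℚ ⧸ fqKer hE φ)) c ?_ q₀
      (Finset.mem_univ q₀)
    funext x
    simp only [Finset.sum_apply, Pi.smul_apply, smul_eq_mul, Pi.zero_apply]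
    have h := hzero x
    rw [avgTwist, Finset.sum_apply] at h
    rw [← h]
    exact Finset.sum_congr rfl fun q _ ↦ hterm q x
  obtain ⟨θ, hθ⟩ := Submodule.exists_forall_notMem_of_forall_ne_top
    (fun i : {i : Fin 4 // i ≠ 0} ↦ LinearMap.ker (avgLin hE φ i.1)) (fun i ↦ hne i.1 i.2)
  exact ⟨θ, fun i hi h0 ↦ hθ ⟨i, hi⟩ (LinearMap.mem_ker.mpr h0)⟩

end Average

/-! ## §6 The twisted invariant `w`, the plain invariant `δ = w²`, the roots `eᵢ`, and the conic -/

section Conic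

variable {AB : ℤ × ℤ} (hE : 4 * AB.1 ^ 3 + 27 * AB.2 ^ 2 ≠ 0)
  (φ : contOneCocycles (discreteTopRep (Field.absoluteGaloisGroup ℚ) (geomTorsion (shortWeierstrass AB) 2)))

/-- **The twisted invariant** `w` (a nonvanishing average). [folklore] -/
def twInv : Fin 4 → AlgebraicClosure ℚ :=
  avgTwist hE φ (Classical.choose (exists_avgTwist_ne_zero hE φ))

/-- `w` is twisted-invariant: `σ ∗ w = w`. [folklore] -/
theorem twist_twInv (σ : Field.absoluteGaloisGroup ℚ) : twist hE φ σ (twInv hE φ) = twInv hE φ :=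
  twist_avgTwist hE φ _ σ

/-- `w(i) ≠ 0` for `i = 1, 2, 3`. [folklore] -/
theorem twInv_ne_zero {i : Fin 4} (hi : i ≠ 0) : twInv hE φ i ≠ 0 :=
  Classical.choose_spec (exists_avgTwist_ne_zero hE φ) i hi

/-- Twisted invariance, pointwise: `σ (w (κ_σ⁻¹ i)) = sgn (idx σ) i · w i`. [folklore] -/
theorem gal_twInv (σ : Field.absoluteGaloisGroup ℚ) (i : Fin 4) :
    gal σ (twInv hE φ ((rootPerm hE σ)⁻¹ i)) = (sgn (idx hE φ σ) i : AlgebraicClosure ℚ) * twInv hE φ i := by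
  have h := congrFun (twist_twInv hE φ σ) i
  rw [twist_apply] at h
  rw [← h, ← mul_assoc, ← Int.cast_mul, sgn_sq, Int.cast_one, one_mul]

/-- **The plain invariant** `δ = w²`. [folklore] -/
def delta (i : Fin 4) : AlgebraicClosure ℚ := twInv hE φ i ^ 2

/-- `δ` is Galois-equivariant for the *untwisted* action: `σ (δ j) = δ (κ_σ j)`. [folklore] -/
theorem gal_delta (σ : Field.absoluteGaloisGroup ℚ) (j : Fin 4) : gal σ (delta hE φ j) = delta hE φ (rootPerm hE σ j) := by
  have h := twist_sq hE φ σ (twInv hE φ) (rootPerm hE σ j)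
  rw [twist_twInv, Equiv.Perm.inv_def, Equiv.symm_apply_apply] at h
  rw [delta, delta, h]

/-- `δ i ≠ 0` for `i ≠ 0`. [folklore] -/
theorem delta_ne_zero {i : Fin 4} (hi : i ≠ 0) : delta hE φ i ≠ 0 := pow_ne_zero _ (twInv_ne_zero hE φ hi)

/-- **The roots of the cubic** through the bootstrap form: `e_k = x(r₀, r_k)` (`k = 1, 2, 3`).
[folklore] -/
def eb (k : Fin 4) : AlgebraicClosure ℚ :=
  torsX ((bootForm AB).map (algebraMap ℚ _)) (algebraMap ℚ _ 2) ((bootData (Ω := AlgebraicClosure ℚ) hE).r 0)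
    ((bootData hE).r k)

/-- `eᵢ` are permuted by Galois like the roots: `σ (e_k) = e_{κ_σ k}`. [folklore] -/
theorem gal_eb (σ : Field.absoluteGaloisGroup ℚ) (k : Fin 4) : gal σ (eb hE k) = eb hE (rootPerm hE σ k) := by
  rw [eb, eb, ← rootPerm_spec hE σ k]
  conv_rhs => rw [← rootPerm_zero hE σ, ← rootPerm_spec hE σ 0]
  have hmap := map_map_algebraMap (g := bootForm AB) (gal σ : AlgebraicClosure ℚ →ₐ[ℚ] AlgebraicClosure ℚ) (gal σ)
    (fun _ ↦ rfl)
  have h := torsX_map ((gal σ : AlgebraicClosure ℚ →ₐ[ℚ] AlgebraicClosure ℚ) : AlgebraicClosure ℚ →+* AlgebraicClosure ℚ)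
    ((bootForm AB).map (algebraMap ℚ _)) (algebraMap ℚ _ 2) ((bootData hE).r 0) ((bootData hE).r k)
  rw [hmap] at h
  simp only [AlgHom.coe_toRingHom, AlgHom.commutes] at h
  exact h.symm

/-- **Vieta** for the `eᵢ`: `e₁ + e₂ + e₃ = 0`, `e₁e₂ + e₁e₃ + e₂e₃ = A`, `e₁e₂e₃ = −B`. [folklore] -/
theorem eb_vieta : eb hE 1 + eb hE 2 + eb hE 3 = 0 ∧
    eb hE 1 * eb hE 2 + eb hE 1 * eb hE 3 + eb hE 2 * eb hE 3 = algebraMap ℚ (AlgebraicClosure ℚ) (AB.1 : ℚ) ∧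
    eb hE 1 * eb hE 2 * eb hE 3 = -algebraMap ℚ (AlgebraicClosure ℚ) (AB.2 : ℚ) := by
  have h := setup_bootForm_map hE
  exact torsX_vieta (bootData (Ω := AlgebraicClosure ℚ) hE) (by norm_num) h.t_ne h.I_eq h.J_eq

/-- Each `e_k` is a root of the cubic: `e_k³ + A e_k + B = 0` (`k ≠ 0`). [folklore] -/
theorem eb_cubic {k : Fin 4} (hk : k ≠ 0) :
    eb hE k ^ 3 + algebraMap ℚ (AlgebraicClosure ℚ) (AB.1 : ℚ) * eb hE k + algebraMap ℚ _ (AB.2 : ℚ) = 0 := by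
  have h := setup_bootForm_map hE
  exact (bootData hE).torsX_cubic (by norm_num) h.t_ne h.I_eq h.J_eq (Ne.symm hk)

/-- The `e_k` (`k = 1, 2, 3`) are distinct. [folklore] -/
theorem eb_injective {k l : Fin 4} (hk : k ≠ 0) (hl : l ≠ 0) (h : eb hE k = eb hE l) : k = l := by
  have hs := setup_bootForm_map hE
  have h3 : (3 : AlgebraicClosure ℚ) ≠ 0 := by norm_num
  have ht2 : (3 : AlgebraicClosure ℚ) * algebraMap ℚ (AlgebraicClosure ℚ) 2 ^ 2 ≠ 0 := mul_ne_zero h3 (pow_ne_zero _ hs.t_ne)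
  have hphi : phi ((bootForm AB).map (algebraMap ℚ (AlgebraicClosure ℚ))) ((bootData hE).r 0) ((bootData hE).r k) =
      phi ((bootForm AB).map (algebraMap ℚ (AlgebraicClosure ℚ))) ((bootData hE).r 0) ((bootData hE).r l) := by
    simp only [eb, torsX] at h
    rw [div_eq_div_iff ht2 ht2, mul_left_inj' ht2, neg_inj] at h
    exact h
  have h12 := (bootData hE).phi01_ne_phi02 hs.a_ne h3 hs.disc_ne_zero
  have h13 := (bootData hE).phi01_ne_phi03 hs.a_ne h3 hs.disc_ne_zero
  have h23 := (bootData hE).phi02_ne_phi03 hs.a_ne h3 hs.disc_ne_zero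
  fin_cases k <;> fin_cases l <;> first
    | rfl
    | exact absurd rfl hk
    | exact absurd rfl hl
    | exact absurd hphi h12
    | exact absurd hphi.symm h12
    | exact absurd hphi h13
    | exact absurd hphi.symm h13
    | exact absurd hphi h23
    | exact absurd hphi.symm h23

/-- `F′(eᵢ) = 3eᵢ² + A ≠ 0` (the roots are simple). [folklore] -/
theorem deriv_eb_ne_zero {i : Fin 4} (hi : i ≠ 0) :
    3 * eb hE i ^ 2 + algebraMap ℚ (AlgebraicClosure ℚ) (AB.1 : ℚ) ≠ 0 := by
  obtain ⟨hs, hA, -⟩ := eb_vieta hE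
  -- `3e_i² + A = (e_i - e_j)(e_i - e_k)`
  have key : ∀ {i j k : Fin 4}, i ≠ 0 → j ≠ 0 → k ≠ 0 → i ≠ j → i ≠ k → j ≠ k →
      eb hE i + eb hE j + eb hE k = 0 → eb hE i * eb hE j + eb hE i * eb hE k + eb hE j * eb hE k = algebraMap ℚ _ (AB.1 : ℚ) →
      3 * eb hE i ^ 2 + algebraMap ℚ (AlgebraicClosure ℚ) (AB.1 : ℚ) ≠ 0 := by
    intro i j k hi hj hk hij hik hjk hs hA
    rw [show 3 * eb hE i ^ 2 + algebraMap ℚ (AlgebraicClosure ℚ) (AB.1 : ℚ) = (eb hE i - eb hE j) * (eb hE i - eb hE k) by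
      rw [← hA]; linear_combination (2 * eb hE i) * hs]
    exact mul_ne_zero (sub_ne_zero.mpr fun h ↦ hij (eb_injective hE hi hj h))
      (sub_ne_zero.mpr fun h ↦ hik (eb_injective hE hi hk h))
  have hi' : i = 1 ∨ i = 2 ∨ i = 3 := by revert i; decide
  rcases hi' with rfl | rfl | rfl
  · exact key (by decide) (by decide) (by decide) (by decide) (by decide) (by decide) hs hA
  · exact key (j := 1) (k := 3) (by decide) (by decide) (by decide) (by decide) (by decide) (by decide)
      (by linear_combination hs) (by linear_combination hA)
  · exact key (j := 1) (k := 2) (by decide) (by decide) (by decide) (by decide) (by decide) (by decide)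
      (by linear_combination hs) (by linear_combination hA)

/-- The summand of the conic entries: `δᵢ eᵢ^{n} / F′(eᵢ)` for `i ≠ 0`, `0` at the junk index `0`.
[folklore] -/
def conicTerm (n : ℕ) (i : Fin 4) : AlgebraicClosure ℚ :=
  if i = 0 then 0 else delta hE φ i * eb hE i ^ n / (3 * eb hE i ^ 2 + algebraMap ℚ (AlgebraicClosure ℚ) (AB.1 : ℚ))

/-- Galois permutes the conic summands: `σ (term n i) = term n (κ_σ i)`. [folklore] -/
theorem gal_conicTerm (σ : Field.absoluteGaloisGroup ℚ) (n : ℕ) (i : Fin 4) :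
    gal σ (conicTerm hE φ n i) = conicTerm hE φ n (rootPerm hE σ i) := by
  unfold conicTerm
  have h0 : rootPerm hE σ i = 0 ↔ i = 0 := by
    constructor
    · intro h; rw [← rootPerm_zero hE σ] at h; exact (rootPerm hE σ).injective h
    · rintro rfl; exact rootPerm_zero hE σ
  by_cases hi : i = 0
  · rw [if_pos hi, if_pos (h0.mpr hi), map_zero]
  · rw [if_neg hi, if_neg (fun h ↦ hi (h0.mp h)), map_div₀, map_mul, map_pow, map_add, map_mul, map_pow,
      AlgEquiv.commutes, gal_delta, gal_eb, map_ofNat]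

/-- **The conic entries** `Q_n = Σᵢ δᵢ eᵢⁿ / F′(eᵢ)` over `ℚ̄`. [folklore] -/
def conicEntry (n : ℕ) : AlgebraicClosure ℚ := ∑ i : Fin 4, conicTerm hE φ n i

/-- The conic entries are Galois-fixed. [folklore] -/
theorem gal_conicEntry (σ : Field.absoluteGaloisGroup ℚ) (n : ℕ) : gal σ (conicEntry hE φ n) = conicEntry hE φ n := by
  rw [conicEntry, map_sum]
  simp_rw [gal_conicTerm]
  exact Equiv.sum_comp (rootPerm hE σ) (conicTerm hE φ n)

/-- **The conic entries are rational.** [folklore] -/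
theorem conicEntry_rational (n : ℕ) : ∃ q : ℚ, algebraMap ℚ (AlgebraicClosure ℚ) q = conicEntry hE φ n :=
  exists_algebraMap_eq_of_fixed ℚ _ fun σ ↦ gal_conicEntry hE φ σ n

/-- The rational conic entries `Q_n ∈ ℚ`. [folklore] -/
def conicEntryQ (n : ℕ) : ℚ := Classical.choose (conicEntry_rational hE φ n)

/-- Defining property of `conicEntryQ`. [folklore] -/
theorem algebraMap_conicEntryQ (n : ℕ) : algebraMap ℚ (AlgebraicClosure ℚ) (conicEntryQ hE φ n) = conicEntry hE φ n :=
  Classical.choose_spec (conicEntry_rational hE φ n)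

/-- **The rational conic** `q(u₀, u₁, u₂) = Σᵢ δᵢ (u₀ + u₁eᵢ + u₂eᵢ²)² / F′(eᵢ) = uᵀ Q u`, as the
symmetric Hankel matrix `Q_{ab} = Q_{a+b}` (Cremona 2001, §5: the conic `Q(u, v, w) = 0` attached to
a `2`-covering; B–SD 1963, Lemma 1). [cite: Cremona2001, §5 (the conic Q(u,v,w) = 0)] -/
def conicMat : Matrix (Fin 3) (Fin 3) ℚ := Matrix.of fun a b ↦ conicEntryQ hE φ (a.1 + b.1)

/-- The conic matrix is symmetric. [folklore] -/
theorem conicMat_isSymm : (conicMat hE φ).IsSymm := by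
  ext a b; simp [conicMat, Nat.add_comm]

end Conic

/-! ## §7 The conic as a quadratic form; nondegeneracy -/

section ConicForm

open Literature.NumberTheory.QuadraticForms

variable {F : Type*} [Field F]

/-- **Hankel quadratic forms**: for a Hankel matrix `Q_{ab} = Σᵢ dᵢ eᵢ^{a+b}` (`a, b ∈ Fin 3`),
`ᵗv Q v = Σᵢ dᵢ (v₀ + v₁eᵢ + v₂eᵢ²)²`. [folklore] -/
theorem toBilin'_hankel {ι : Type*} (s : Finset ι) (d e : ι → F) (v : Fin 3 → F) :
    Matrix.toBilin' (Matrix.of fun a b : Fin 3 ↦ ∑ i ∈ s, d i * e i ^ (a.1 + b.1)) v v =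
      ∑ i ∈ s, d i * (v 0 + v 1 * e i + v 2 * e i ^ 2) ^ 2 := by
  rw [Matrix.toBilin'_apply]
  simp only [Matrix.of_apply, Fin.sum_univ_three, Fin.val_zero, Fin.val_one, Fin.val_two, Finset.mul_sum,
    Finset.sum_mul]
  rw [← Finset.sum_add_distrib, ← Finset.sum_add_distrib, ← Finset.sum_add_distrib, ← Finset.sum_add_distrib,
    ← Finset.sum_add_distrib, ← Finset.sum_add_distrib, ← Finset.sum_add_distrib, ← Finset.sum_add_distrib]
  refine Finset.sum_congr rfl fun i _ ↦ ?_
  ring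

/-- A Hankel matrix on three nodes factors as `Vᵀ D V` with `V` the Vandermonde matrix. [folklore] -/
theorem hankel_eq_vandermonde (d : Fin 3 → F) (e : Fin 3 → F) :
    (Matrix.of fun a b : Fin 3 ↦ ∑ i, d i * e i ^ (a.1 + b.1)) =
      (Matrix.vandermonde e).transpose * Matrix.diagonal d * Matrix.vandermonde e := by
  ext a b
  simp only [Matrix.of_apply, Matrix.mul_apply, Matrix.diagonal_apply, Matrix.transpose_apply, Matrix.vandermonde,
    Fin.sum_univ_three]
  simp only [Fin.isValue, mul_ite, mul_zero, if_true]
  fin_cases a <;> fin_cases b <;> simp <;> ring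

/-- **Nondegeneracy of a Hankel form** with distinct nodes and nonzero weights. [folklore] -/
theorem det_hankel_ne_zero {d e : Fin 3 → F} (hd : ∀ i, d i ≠ 0) (he : Function.Injective e) :
    (Matrix.of fun a b : Fin 3 ↦ ∑ i, d i * e i ^ (a.1 + b.1)).det ≠ 0 := by
  rw [hankel_eq_vandermonde, Matrix.det_mul, Matrix.det_mul, Matrix.det_transpose, Matrix.det_diagonal]
  have hV := Matrix.det_vandermonde_ne_zero_iff.mpr he
  exact mul_ne_zero (mul_ne_zero hV (Finset.prod_ne_zero_iff.mpr fun i _ ↦ hd i)) hV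

variable {AB : ℤ × ℤ} (hE : 4 * AB.1 ^ 3 + 27 * AB.2 ^ 2 ≠ 0)
  (φ : contOneCocycles (discreteTopRep (Field.absoluteGaloisGroup ℚ) (geomTorsion (shortWeierstrass AB) 2)))

/-- The conic matrix over `ℚ̄` is the Hankel matrix of the weights `δᵢ/F′(eᵢ)` at the nodes `eᵢ`
(`i = 1, 2, 3`). [folklore] -/
theorem conicMat_map : (conicMat hE φ).map (algebraMap ℚ (AlgebraicClosure ℚ)) =
    Matrix.of fun a b : Fin 3 ↦ ∑ i : Fin 3,
      (delta hE φ i.succ / (3 * eb hE i.succ ^ 2 + algebraMap ℚ (AlgebraicClosure ℚ) (AB.1 : ℚ))) * eb hE i.succ ^ (a.1 + b.1) := by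
  ext a b
  simp only [Matrix.map_apply, conicMat, Matrix.of_apply, algebraMap_conicEntryQ, conicEntry, Fin.sum_univ_four,
    Fin.sum_univ_three, conicTerm]
  simp only [Fin.isValue, if_true, zero_add, one_ne_zero, if_false, Fin.succ_zero_eq_one, Fin.succ_one_eq_two,
    show (2 : Fin 4) ≠ 0 by decide, show (3 : Fin 4) ≠ 0 by decide, show Fin.succ (2 : Fin 3) = 3 by decide]
  ring

/-- **The conic is nondegenerate**: `det Q ≠ 0`. [folklore] -/
theorem conicMat_det_ne_zero : (conicMat hE φ).det ≠ 0 := by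
  intro h0
  have h := congrArg (algebraMap ℚ (AlgebraicClosure ℚ)) h0
  rw [map_zero, RingHom.map_det, RingHom.mapMatrix_apply, conicMat_map] at h
  refine det_hankel_ne_zero (fun i ↦ ?_) (fun i j hij ↦ Fin.succ_injective _ (eb_injective hE (Fin.succ_ne_zero _)
    (Fin.succ_ne_zero _) hij)) h
  exact div_ne_zero (delta_ne_zero hE φ (Fin.succ_ne_zero _)) (deriv_eb_ne_zero hE (Fin.succ_ne_zero _))

/-- The quadratic form of the conic over `ℚ̄`: `ᵗv Q v = Σᵢ (δᵢ/F′(eᵢ)) (v₀ + v₁eᵢ + v₂eᵢ²)²`.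
[folklore] -/
theorem toBilin'_conicMat_map (v : Fin 3 → AlgebraicClosure ℚ) :
    Matrix.toBilin' ((conicMat hE φ).map (algebraMap ℚ (AlgebraicClosure ℚ))) v v =
      ∑ i : Fin 3, (delta hE φ i.succ / (3 * eb hE i.succ ^ 2 + algebraMap ℚ (AlgebraicClosure ℚ) (AB.1 : ℚ))) *
        (v 0 + v 1 * eb hE i.succ + v 2 * eb hE i.succ ^ 2) ^ 2 := by
  rw [conicMat_map]
  exact toBilin'_hankel Finset.univ _ _ v

end ConicForm

end TwoCovering

end Literature.NumberTheory.EllipticCurves
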